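import Mathlib
import Literature.Probability.Percolation.CLE6
import Literature.Probability.Percolation.InterfaceLoopPolygon
import Literature.Probability.Percolation.SitePaths
import Literature.Probability.Percolation.SiteInterfaceStructure
import Literature.Probability.Percolation.SiteNestingWeightBound
import Literature.Probability.Percolation.HexPolygonSubarcs
import Literature.Probability.Percolation.AltFourArmOfCrossingLoops
import Literature.Probability.LatticeModels.TriangularLatticeProofs
import Summits.CriticalPhenomena.CardyFormulaZ2.Theorems.CardyMagicRigidityLoopLimitZ2EqTSiteEndMetric
import Summits.CriticalPhenomena.CardyFormulaZ2.Theorems.CardyMagicRigidityLoopLimitZ2EqTCFT1Local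
import HarnessLib

/-!
# Stub `stub_cft1` (S2a) of line `Sketch`, crux `LoopLimitZ2EqT` (stmt-CriticalPhenomena-4833):
# walk bookkeeping for the combinatorial fellow-travelling

Helper file (`--supports stmt-CriticalPhenomena-4833`), second part of (CFT1): generic facts
about closed honeycomb walks and interface loops used by the fellow-travelling induction
(`…CFT1.lean`), none of which depends on the type of the loops:

* `cft_dist_le_twelve` — the metric bound of the coupling from integer coordinate bounds
  (`siteEnd_dist_two_hexCenter_le`);
* `cft_abs_sub_le_one_of_adj`, `cft_getVert_dev` — consecutive faces of a honeycomb walk have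
  cells differing by at most `1` in each coordinate, so `s` steps move the cell by at most `s`;
* `cft_eq_length_of_getVert_eq` — a cycle returns to its base only at the end;
* `cft_lv_rv_rotateAt` — the crossed darts of a rotated interface loop;
* `cft_exists_rebase` — rebasing an interface loop at a visited face (same unbased loop at
  every mesh, same set of visited faces; cf. `IsSiteInterfaceLoop.exists_rebase`);
* **`cft_sync`** — the synchronisation point of the two outer boundaries: for a type-`1` loop `Γ`
  of `τ` and a type-`1` loop `γ` of the blow-up `β τ` whose left cluster contains the block
  centre of `lv₀(Γ)`, with `c⋆` a rightmost cell of the left cluster of `Γ`, the coarse loop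
  visits the up face `(c⋆, 0)` (`siteEnd_hexDart_mem_darts`) and the fine loop visits the middle
  face `(2c⋆ + (1,1), 0)` of its blow-up (two forced interface steps after the dart of
  `siteEnd_fine_hexDart_mem_darts`, by `cft_down_short_chain`).
-/

noncomputable section

open Set Metric

namespace Summit.CriticalPhenomena.CardyFormulaZ2.Cruxes.LoopLimitZ2EqT.HexSegment

open Literature.Probability.Percolation Literature.Probability.LatticeModels
  Literature.Probability.RandomPlanarGeometry

attribute [local simp] cft_faceVertex_apply cft_oppFace_fst_apply cft_oppFace_snd

/-! ### Metric bound from coordinates -/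

/-- **The coupling distance from coordinate bounds**: if the cell of the fine face is within `5`
of the doubled cell of the coarse face in each coordinate, the doubled coarse centre and the fine
centre are within `12`. -/
theorem cft_dist_le_twelve (G g : HexVertex) (h0 : |g.1 0 - 2 * G.1 0| ≤ 5)
    (h1 : |g.1 1 - 2 * G.1 1| ≤ 5) : dist (2 * hexCenter G) (hexCenter g) ≤ 12 := by
  have h := siteEnd_dist_two_hexCenter_le G g
  have h0' : |((g.1 0 : ℤ) : ℝ) - 2 * ((G.1 0 : ℤ) : ℝ)| ≤ 5 := by exact_mod_cast h0
  have h1' : |((g.1 1 : ℤ) : ℝ) - 2 * ((G.1 1 : ℤ) : ℝ)| ≤ 5 := by exact_mod_cast h1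
  linarith

/-! ### Monotone unit-step couplings -/

/-- The trivial coupling `(0, 0)`. -/
theorem cft_align_zero {P : ℕ → ℕ → Prop} (h : P 0 0) :
    ∃ (K : ℕ) (i j : ℕ → ℕ), i 0 = 0 ∧ j 0 = 0 ∧ i K = 0 ∧ j K = 0 ∧
      (∀ k < K, i (k + 1) = i k ∨ i (k + 1) = i k + 1) ∧
      (∀ k < K, j (k + 1) = j k ∨ j (k + 1) = j k + 1) ∧ ∀ k ≤ K, P (i k) (j k) :=
  ⟨0, fun _ => 0, fun _ => 0, rfl, rfl, rfl, rfl, fun k hk => (Nat.not_lt_zero k hk).elim,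
    fun k hk => (Nat.not_lt_zero k hk).elim, fun _ _ => h⟩

/-- **Extending a monotone unit-step coupling by one pair**: from a coupling ending at `(a, b)`
to one ending at `(a', b')` with `a' ∈ {a, a+1}`, `b' ∈ {b, b+1}`, provided `P a' b'`. -/
theorem cft_align_snoc {P : ℕ → ℕ → Prop} {a b a' b' : ℕ}
    (h : ∃ (K : ℕ) (i j : ℕ → ℕ), i 0 = 0 ∧ j 0 = 0 ∧ i K = a ∧ j K = b ∧
      (∀ k < K, i (k + 1) = i k ∨ i (k + 1) = i k + 1) ∧
      (∀ k < K, j (k + 1) = j k ∨ j (k + 1) = j k + 1) ∧ ∀ k ≤ K, P (i k) (j k))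
    (ha : a' = a ∨ a' = a + 1) (hb : b' = b ∨ b' = b + 1) (hP : P a' b') :
    ∃ (K : ℕ) (i j : ℕ → ℕ), i 0 = 0 ∧ j 0 = 0 ∧ i K = a' ∧ j K = b' ∧
      (∀ k < K, i (k + 1) = i k ∨ i (k + 1) = i k + 1) ∧
      (∀ k < K, j (k + 1) = j k ∨ j (k + 1) = j k + 1) ∧ ∀ k ≤ K, P (i k) (j k) := by
  obtain ⟨K, i, j, hi0, hj0, hiK, hjK, hi, hj, hPk⟩ := h
  refine ⟨K + 1, fun k => if k ≤ K then i k else a', fun k => if k ≤ K then j k else b',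
    by simp [hi0], by simp [hj0], by simp, by simp, fun k hk => ?_, fun k hk => ?_, fun k hk => ?_⟩
  · dsimp only
    rcases Nat.lt_succ_iff_lt_or_eq.1 hk with hk | rfl
    · rw [if_pos hk.le, if_pos (by omega)]; exact hi k hk
    · rw [if_pos le_rfl, if_neg (by omega), hiK]; exact ha
  · dsimp only
    rcases Nat.lt_succ_iff_lt_or_eq.1 hk with hk | rfl
    · rw [if_pos hk.le, if_pos (by omega)]; exact hj k hk
    · rw [if_pos le_rfl, if_neg (by omega), hjK]; exact hb
  · dsimp only
    rcases Nat.lt_succ_iff_lt_or_eq.1 (Nat.lt_succ_of_le hk) with hk | rfl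
    · rw [if_pos (Nat.lt_succ_iff.1 hk), if_pos (Nat.lt_succ_iff.1 hk)]; exact hPk k (Nat.lt_succ_iff.1 hk)
    · rw [if_neg (Nat.not_succ_le_self K), if_neg (Nat.not_succ_le_self K)]; exact hP

/-! ### Cells of vertices and of consecutive faces -/

/-- The vertices of a down face `(u, 1)` are `u + (1,0)`, `u + (1,1)`, `u + (0,1)`. -/
theorem cft_faceVertex_down_sub {g : HexVertex} (hg : g.2 = 1) (k : Fin 3) :
    (faceVertex g k 0 - g.1 0 = 1 ∧ faceVertex g k 1 - g.1 1 = 0) ∨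
      (faceVertex g k 0 - g.1 0 = 1 ∧ faceVertex g k 1 - g.1 1 = 1) ∨
      (faceVertex g k 0 - g.1 0 = 0 ∧ faceVertex g k 1 - g.1 1 = 1) := by
  obtain ⟨x, a⟩ := g
  simp only at hg
  subst hg
  fin_cases k <;> simp


/-- Adjacent faces of the honeycomb lattice have cells differing by at most `1` in each
coordinate. -/
theorem cft_abs_sub_le_one_of_adj {g g' : HexVertex} (h : hexGraph.Adj g g') (k : Fin 2) :
    |g'.1 k - g.1 k| ≤ 1 := by
  obtain ⟨x, a⟩ := g
  obtain ⟨y, b⟩ := g'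
  fin_cases a <;> fin_cases b
  · exact absurd h (not_hexGraph_adj_of_snd_eq_holds _ _ rfl)
  · rcases (hexGraph_adj_iff_of_snd_eq_zero_holds x y).1 h with rfl | rfl | rfl <;> fin_cases k <;> simp
  · rcases (hexGraph_adj_iff_of_snd_eq_one x y).1 h with rfl | rfl | rfl <;> fin_cases k <;> simp
  · exact absurd h (not_hexGraph_adj_of_snd_eq_holds _ _ rfl)

/-- **`s` steps of a honeycomb walk move the cell by at most `s` in each coordinate** (also past
the end, where the walk stays at its last face). -/
theorem cft_getVert_dev {f f' : HexVertex} (w : hexGraph.Walk f f') (J : ℕ) (k : Fin 2) :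
    ∀ s : ℕ, |(w.getVert (J + s)).1 k - (w.getVert J).1 k| ≤ s
  | 0 => by simp
  | s + 1 => by
    have h1 : |(w.getVert (J + s + 1)).1 k - (w.getVert (J + s)).1 k| ≤ 1 := by
      by_cases hlt : J + s < w.length
      · exact cft_abs_sub_le_one_of_adj (w.adj_getVert_succ hlt) k
      · rw [w.getVert_of_length_le (not_lt.1 hlt), w.getVert_of_length_le (by omega)]
        simp
    have h2 := cft_getVert_dev w J k s
    calc |(w.getVert (J + (s + 1))).1 k - (w.getVert J).1 k|
        ≤ |(w.getVert (J + s + 1)).1 k - (w.getVert (J + s)).1 k| +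
            |(w.getVert (J + s)).1 k - (w.getVert J).1 k| := by
          rw [← add_assoc]; exact abs_sub_le _ _ _
      _ ≤ 1 + s := add_le_add h1 h2
      _ = (s + 1 : ℕ) := by push_cast; ring

/-! ### Cycles, rotations, rebasings -/

/-- **A cycle returns to its base only at the end**: if `0 < J ≤ n` and the `J`-th vertex is the
base then `J = n`. -/
theorem cft_eq_length_of_getVert_eq {V : Type*} {G : SimpleGraph V} {v : V} {γ : G.Walk v v}
    (hc : γ.IsCycle) {J : ℕ} (hJ0 : 0 < J) (hJ : J ≤ γ.length) (h : γ.getVert J = γ.getVert 0) :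
    J = γ.length := by
  by_contra hne
  have := hc.getVert_injOn' (by simp only [Set.mem_setOf_eq]; omega)
    (by simp only [Set.mem_setOf_eq]; omega) h
  omega

/-- **The crossed darts of a rotated interface loop**: the `j`-th step of `w.rotateAt k` crosses
the dart of the `((j + k) % n)`-th step of `w`. -/
theorem cft_lv_rv_rotateAt {ω : SiteConfig (Site 2)} {f₀ : HexVertex} {w : hexGraph.Walk f₀ f₀}
    (hw : IsSiteInterfaceLoop ω w) {k : ℕ} (hk0 : 0 < k) (hk : k ≤ w.length) {j : ℕ} (hj : j < w.length) :
    (hw.rotateAt hk0 hk).lv j = hw.lv ((j + k) % w.length) ∧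
      (hw.rotateAt hk0 hk).rv j = hw.rv ((j + k) % w.length) := by
  have hn : 0 < w.length := by omega
  have hj' : j < (w.rotateAt k).length := by rwa [SimpleGraph.Walk.length_rotateAt w hk]
  have hm : (j + k) % w.length < w.length := Nat.mod_lt _ hn
  obtain ⟨h₁, hf₁, -⟩ := (hw.rotateAt hk0 hk).dart_spec hj'
  obtain ⟨h₂, hf₂, -⟩ := hw.dart_spec hm
  obtain ⟨e1, e2⟩ := getVert_rotateAt_mod hk hj
  rw [e1, e2, ← hf₂] at hf₁
  exact eq_of_triEdgeFaces_eq _ _ hf₁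

/-- **Rebasing an interface loop at a visited face**: some interface loop of `ω` based at `u`
has the same unbased loop as `γ` at every mesh and visits only faces visited by `γ`
(`IsSiteInterfaceLoop.exists_rebase`, with the mesh quantified inside). -/
theorem cft_exists_rebase {ω : SiteConfig (Site 2)} {f₀ : HexVertex} {γ : hexGraph.Walk f₀ f₀}
    (hγ : IsSiteInterfaceLoop ω γ) {u : HexVertex} (hu : u ∈ γ.support) :
    ∃ w : hexGraph.Walk u u, IsSiteInterfaceLoop ω w ∧
      (∀ δ : ℝ, UnbasedLoop.mk (BasedLoop.mk (siteLoopCurve δ w) (isLoop_siteLoopCurve δ w)) =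
        UnbasedLoop.mk (BasedLoop.mk (siteLoopCurve δ γ) (isLoop_siteLoopCurve δ γ))) ∧
      ∀ x ∈ w.support, x ∈ γ.support := by
  obtain ⟨i, rfl, hi⟩ := SimpleGraph.Walk.mem_support_iff_exists_getVert.1 hu
  rcases Nat.eq_zero_or_pos i with rfl | hi0
  · rw [SimpleGraph.Walk.getVert_zero]
    exact ⟨γ, hγ, fun δ => rfl, fun x hx => hx⟩
  · refine ⟨γ.rotateAt i, hγ.rotateAt hi0 hi, fun δ => unbasedLoop_siteLoopCurve_rotateAt δ γ hi0 hi,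
      fun x hx => ?_⟩
    obtain ⟨j, rfl, -⟩ := SimpleGraph.Walk.mem_support_iff_exists_getVert.1 hx
    rw [SimpleGraph.Walk.getVert_rotateAt]
    split_ifs <;> exact SimpleGraph.Walk.getVert_mem_support _ _

/-! ### The synchronisation point of the coarse and fine outer boundaries -/

/-- **Synchronisation of the two outer boundaries.** Let `Γ` be a type-`1` interface loop of `τ`
and `γ` a type-`1` interface loop of the blow-up `β τ` whose left cluster contains the block
centre of `lv₀(Γ)`, and let `c⋆` be a rightmost cell of the (finite) left cluster of `Γ`. Then
`Γ` visits the up face `(c⋆, 0)` — at a positive position — and `γ` visits the middle face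
`(2c⋆ + (1,1), 0)` of its blow-up: `γ` crosses `hexDart (2c⋆ + (2,0)) 5`
(`siteEnd_fine_hexDart_mem_darts`) into the corner face of `T(c⋆ + e₀)` at the corner
`2c⋆ + (2,0)`, from where the next two interface steps are forced (`cft_down_short_chain` at the
down face `(c⋆ - e₁, 1)`, whose vertex `c⋆ + e₀` is closed and whose vertex `c⋆` is open). -/
theorem cft_sync : ∀ {τ : SiteConfig (Site 2)} {F : HexVertex} {Γ : hexGraph.Walk F F} (hΓ : IsSiteInterfaceLoop τ Γ) {f : HexVertex} {γ : hexGraph.Walk f f} (hγ : IsSiteInterfaceLoop {v : Site 2 | (∀ j, (2 : ℤ) ∣ v j) ∨ (fun j => v j / 2) ∈ τ} γ), 0 < shoelace (Γ.support.map hexCenter) → 0 < shoelace (γ.support.map hexCenter) → PathIn triGraph {v : Site 2 | (∀ j, (2 : ℤ) ∣ v j) ∨ (fun j => v j / 2) ∈ τ} (fun j => 2 * hΓ.lv 0 j + 1) (hγ.lv 0) → ∃ c : Site 2, (∃ k : ℕ, 0 < k ∧ k ≤ Γ.length ∧ Γ.getVert k = (c, 0)) ∧ ((fun j => c j + c j +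 1 : Site 2), (0 : Fin 2)) ∈ γ.support := by
  intro τ F Γ hΓ f γ hγ hΓpos hγpos hp
  have hlen : 0 < Γ.length := by have := hΓ.isCycle.three_le_length; omega
  have hfin := siteEnd_finite_cluster_of_shoelace_pos hΓ hΓpos
  obtain ⟨c, hc, hmax⟩ := Set.exists_max_image _ (fun x : Site 2 => x 0) hfin
    ⟨hΓ.lv 0, PathIn.refl (hΓ.lv_mem hlen)⟩
  have hmax' : ∀ x, PathIn triGraph τ (hΓ.lv 0) x → x 0 ≤ c 0 := fun x hx => hmax x hx
  refine ⟨c, ?_, ?_⟩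
  · -- the coarse loop crosses `hexDart c 5`, whose head is the up face `(c, 0)`
    have hd : hexDart c 5 ∈ Γ.darts := siteEnd_hexDart_mem_darts hΓ hΓpos hc hmax'
    have hmem : ((c, 0) : HexVertex) ∈ Γ.support := by
      have h := Γ.dart_snd_mem_support_of_mem_darts hd
      have e : (hexDart c 5).snd = (c, 0) := by
        show hexFace c (5 + 1) = (c, 0)
        rw [show (5 : Fin 6) + 1 = 0 from rfl]
        exact hexFace_zero c
      rwa [e] at h
    obtain ⟨k, hk, hkn⟩ := SimpleGraph.Walk.mem_support_iff_exists_getVert.1 hmem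
    rcases Nat.eq_zero_or_pos k with rfl | hk0
    · refine ⟨Γ.length, hlen, le_rfl, ?_⟩
      rw [SimpleGraph.Walk.getVert_length, ← hk, SimpleGraph.Walk.getVert_zero]
    · exact ⟨k, hk0, hkn, hk⟩
  · -- the fine loop crosses `hexDart ĉ 5` into `(ĉ, 0)`, then two forced steps
    have hd := siteEnd_fine_hexDart_mem_darts hΓ hγ hγpos hp hc hmax'
    set ch : Site 2 := ![2 * c 0 + 2, 2 * c 1] with hch
    have hmem : ((ch, 0) : HexVertex) ∈ γ.support := by
      have h := γ.dart_snd_mem_support_of_mem_darts hd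
      have e : (hexDart ch 5).snd = (ch, 0) := by
        show hexFace ch (5 + 1) = (ch, 0)
        rw [show (5 : Fin 6) + 1 = 0 from rfl]
        exact hexFace_zero ch
      rwa [e] at h
    obtain ⟨w, hw, -, hsub⟩ := cft_exists_rebase hγ hmem
    -- the down face `G = (c - e₁, 1)` below `(c, 0)`: vertex `1` is `c + e₀` (closed), vertex `2` is `c`
    have ha : faceVertex (((![c 0, c 1 - 1] : Site 2), (1 : Fin 2)) : HexVertex) 1 ∉ τ := fun h => by
      have hadj : triGraph.Adj c (faceVertex (((![c 0, c 1 - 1] : Site 2), (1 : Fin 2)) : HexVertex) 1) :=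
        siteEnd_adj_of_coords (Or.inl ⟨by simp, by simp⟩)
      have := hmax' _ (hc.tail hadj h)
      simp at this
    have hb : faceVertex (((![c 0, c 1 - 1] : Site 2), (1 : Fin 2)) : HexVertex) (1 + 1) ∈ τ := by
      have e : faceVertex (((![c 0, c 1 - 1] : Site 2), (1 : Fin 2)) : HexVertex) (1 + 1) = c := by
        funext i; fin_cases i <;> simp
      rw [e]; exact hc.right_mem
    obtain ⟨c1, c2⟩ := cft_down_short_chain (τ := τ) (G := (((![c 0, c 1 - 1] : Site 2), (1 : Fin 2)) : HexVertex))
      rfl ha hb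
    have hstart : ((fun j => faceVertex (((![c 0, c 1 - 1] : Site 2), (1 : Fin 2)) : HexVertex) 1 j +
        (((![c 0, c 1 - 1] : Site 2), (1 : Fin 2)) : HexVertex).1 j + 1 : Site 2), (0 : Fin 2)) = ((ch, 0) : HexVertex) :=
      Prod.ext (funext fun i => by fin_cases i <;> simp [hch] <;> omega) rfl
    have hend : ((fun j => (oppFace (((![c 0, c 1 - 1] : Site 2), (1 : Fin 2)) : HexVertex) (1 + 2)).1 j +
        (oppFace (((![c 0, c 1 - 1] : Site 2), (1 : Fin 2)) : HexVertex) (1 + 2)).1 j + 1 : Site 2), (0 : Fin 2)) =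
        ((fun j => c j + c j + 1 : Site 2), (0 : Fin 2)) :=
      Prod.ext (funext fun i => by fin_cases i <;> simp) rfl
    rw [hstart] at c1 c2
    rw [hend] at c2
    have hwlen : 3 ≤ w.length := hw.isCycle.three_le_length
    have e1 := hw.ifaceSucc_getVert (i := 0) (by omega)
    rw [SimpleGraph.Walk.getVert_zero, c1] at e1
    have e2 := hw.ifaceSucc_getVert (i := 1) (by omega)
    rw [← Option.some.inj e1, c2] at e2
    rw [Option.some.inj e2]
    exact hsub _ (SimpleGraph.Walk.getVert_mem_support _ _)

end Summit.CriticalPhenomena.CardyFormulaZ2.Cruxes.LoopLimitZ2EqT.HexSegment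

end
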